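import Literature.NumberTheory.EllipticCurves.OchiaiTwoVariableSelmerDual
import Literature.NumberTheory.EllipticCurves.Rank1Residual.MuLambdaCarriers
import Literature.NumberTheory.EllipticCurves.Rank1Residual.X9ImageShape
import Summits.BirchSwinnertonDyer.Rank1Residual.SmallImageMu.KatoDivisibility
import Summits.BirchSwinnertonDyer.BirchSwinnertonDyer.Theses.OneSidedTwistSqueezeX9
import Mathlib.RingTheory.PowerSeries.Inverse
import Mathlib.RingTheory.PowerSeries.Ideal
import Mathlib.RingTheory.Ideal.KrullsHeightTheorem
import Mathlib.RingTheory.Ideal.GoingDown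
import Mathlib.Analysis.Normed.Algebra.Ultra
import HarnessLib
import HarnessLib.Audit

/-!
# LINE `prime_adapted_tau` on crux `KatoDivisibilityX9` — SKELETON (TURNKEY-6 candidate; cell bsd-f3-mu, -imc g20)

Skeleton-line candidate for crux item `stmt-BirchSwinnertonDyer-20547`
(`OneSidedTwistSqueezeX9.KatoDivisibilityX9 := SmallImageMu.KatoDivisibilityOnClassX9`), = the evidence
file `HOME/imc/g20/RoadIV.lean` (§§1–5, sorry-free) + §6: FIVE registered stubs `stub_*` (the only
`sorry`s; v4.3 = road (iv) ∪ road (v), crossing control consumed EXISTENTIALLY per datum (the D-Λ2 presentation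
`X = ℍ^n/rel` is free, so `∀ Δ` forms are junk-enlargeable at non-witness primes — v4.0 defect fixed): -desc g30's
crossing-control dichotomy at the Artin primes copied from `HOME/desc/Sketch30.lean` acacdc393fe9baa9 §2–§3 with
attribution; v3's `NoArtinCrossingAt` hypothesis is GONE — Greenberg–Vatsal torsion + control (stub 4,
PRINT-assemblable on all 624 5S4 rows; v4.3 merges v4.2's non-anomalous / anomalous stubs since by ref1 g18 R-5
an exceptional Artin point carries no extra height-one residue); the Cartan half is the socket `stub_cartanRows`
= `KatoDivisibilityOnCartan` owned by road (v)/(v′)) and the kernel-checked composition `KatoDivisibilityX9_of`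
concluding the ROUTE DECL BY NAME.  **v4.4**: the (HC) conjunct `HeightOneContraction 𝕀` is now a THEOREM for every
noetherian domain (`heightOneContraction_of_isNoetherianRing`, §3: going down along `𝕀 → 𝕀⟦T⟧` via the primes
`p⟦T⟧ᵉ = ker(𝕀⟦T⟧ → (𝕀/p)⟦T⟧)` + Mathlib's `Ideal.height_eq_height_add_of_liesOver_of_hasGoingDown`), hence for
every D-Λ1 coefficient domain (`moduleFinite` over `Λ = ℤ_p⟦X⟧`); it is DROPPED from stub 3's `GoodHidaDatumStructAt`
and supplied inside the kernel — one port fewer, statements of stubs 1/2/4/5 byte-identical to v4.3.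
Registration (`ledger crux write … Lines/prime_adapted_tau.lean` + `ledger skeleton check`) is a LEAD /
coordinator verb (TURNKEY-6); this file is what would be registered.  A SECOND line beside the line of
record `graded_euler_loss` (k6-p4 skeleton v3 380b9845780dc615), not a replacement: its load-bearing stub
is US-S4 (big-image level supply in the Hida family), disjoint from `stub_widthX9` (fine μ-width).

Inputs (tree, landed): D-Λ1 `Literature.NumberTheory.EllipticCurves.HidaFamilyGaloisRepDatum`
(p620871) and D-Λ2 `Literature.NumberTheory.EllipticCurves.OchiaiTwoVariableSelmerDual` (p624085,
commit 45eebb3d9616), in particular the composite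
`OchiaiTwoVariableDatum.exists_unit_mul_padicLFunction_eq` and the cite-only existence fact
`ochiai2006_nonempty_twoVariableDatum` (Ochiai 2006 Thm 3 / Props 4.9, 5.2 / Thm 6.7 = Kitagawa 1994).

## The arrows typed here (ROAD-IV-TYPING-PLAN.md, arrows 1–5)

* §1 DESCENT (pure algebra, PROVED): from `u · L_p(f) = h · ι g` in `ℚ̄_p⟦T⟧` with `u, h ∈ ℤ̄_p⟦T⟧`,
  `‖u₀‖ = 1` (the conclusion of the D-Λ2 composite) to `∃ g', g ∣ g' ∧ ι g' = L_p(f)` in `Λ = ℤ_p⟦T⟧` —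
  i.e. the EXACT-EQUALITY form `KatoDivisibilityAt` asks for (`exists_dvd_and_iwasawaToPowerSeries_eq`;
  lemma A `norm_coeff_le_one_of_mul` = ultrametric leading-term induction).
* §2 WITNESSES (PROVED): a level `b ∈ 𝔲⁺ ∪ 𝔲⁻` of the datum gives Ochiai's `τ ∈ G^cyc` with
  `ρ_𝓕(τ) = P U⁺(b) P⁻¹` (`P = 1` or the Weyl element) — `exists_witness_of_mem_levels`.
* §3 SUPPLY CONVERSION (PROVED modulo the ring-theoretic input (HC)): US-S4's supply at the height-one
  primes of `𝕀` (`D.LevelSupply`) + one nonzero level + (HC) «a height-one prime of `𝕀⟦T⟧` contracts to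
  `0` or to a height-one prime of `𝕀`» (going-down for the flat extension `𝕀 → 𝕀⟦T⟧`; TRUE for every
  noetherian domain, not in Mathlib in this form — kept as the hypothesis `HeightOneContraction I`)
  ⟹ Ochiai's `hτ` at every height-one `𝔩 ⊂ ℍ = 𝕀⟦T⟧` (`ochiaiWitnessSupply_of_levelSupply`).
* §4 PER-DATUM ROAD (PROVED composition): `ochiai2006_nonempty_twoVariableDatum` (PRINT, cite-only) →
  Regime → (Reg) → (HC) → (−1 ∈ im ρ̄) → (U_{I_W} = 0 at v ∣ N_W) → nonzero level → `D.LevelSupply` →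
  `Rank1Residual.KatoDivisibilityAt W p` (`katoDivisibilityAt_of_levelSupply`).
* §5 CLASS ROADS (PROVED compositions): the per-pair package `RoadIVInputAt W p`; on the whole class
  `(∀ X9 pairs, RoadIVInputAt) → KatoDivisibilityOnClassX9` (= item 20547's decl, BY NAME:
  `katoDivisibilityOnClassX9_of_roadIVInput`); and the 5S4 sub-road through US-S4 (restated verbatim
  from `HOME/imc/g20/USS4TypedV2.lean` = v1 f8147a4cd5e0b158 + ref1's C′ binder `Λ ↪ 𝕀`, with the
  TARGET's `ClassX9` predicate):
  `UnipotentLevelSupplyS4 → (good Hida datum without finite projective image at every 5S4 pair) →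
  KatoDivisibilityOn5S4` (`katoDivisibilityOn5S4_of_US_S4`).

## What stays OPEN / unported (the honest stub list of the eventual skeleton `prime_adapted_tau`)
* US-S4 `UnipotentLevelSupplyS4` — OPEN (Lang 2016 Conj. 6.1.2 (4) support half; Lang 2016 Thm 2.4 /
  CLM 2023 Prop 6.6 give a nonzero `B`-level, not prime-to-`P` supply; ref2 M50; cites per ref2 g32 (c3)).  THE crux content.
* `GoodHidaDatumAt W p` — PRINT-but-unported per pair: existence of a Hida datum (Hida 1986 /
  Wiles 1988 — primaries not held, numbering unverified; held locator Ochiai 2006 p. 1161 «ℍ^ord_𝓕 is a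
  local domain, finite flat over ℤ_p⟦Γ′⟧», ref2 g32 (c8)), (Reg) = Ochiai's RING regularity
  `Ochiai2006.IsRegular` for the chosen `𝕀` (may FAIL; NOT CLM's «regular/good», which is automatic on
  5S4 — (c5)), `U_{I_W} = 0` at `v ∣ N_W` (Ochiai 2006 Rem. 7.6: `ord_v(N) ≤ 1` OR finite local
  monodromy — covers multiplicative and additive potentially-good `v`; additive potentially-multiplicative
  `v`: Thm 3.3 (2) with quadratic `η₀` gives `u = −1`, `1 − u` a unit — ref2 g32 reading (c6), one line
  beyond print, ref1 to confirm), `−1 ∈ im ρ̄` (group theory, (c7): `5S4` = the full preimage of `S₄` in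
  `PGL₂(𝔽₅)`, order 96, contains the scalars `𝔽₅^× ∋ −1`; kept as an explicit hypothesis), a nonzero level
  (Lang 2016 Thm 2.4 / CLM 2023 Thm 1.4, Prop 6.6 — (c3); CLM Thm 2.20 is Pink's theorem), (HC)
  (commutative algebra: Matsumura Thm 9.5 / Ex 9.9, going-down for the flat extension `𝕀 → 𝕀⟦T⟧` — (c2)).
* `ochiai2006_nonempty_twoVariableDatum` — PRINT, cite-only (D-Λ2 §5).
* Scope: `NotSplitDihedral` = type 5S4 (624 of the 790 X9 rows); the 130 `5Ns` + 36 `7Ns` rows are NOT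
  reached by this road (US-S4's LEMMA N fails for normaliser-of-split-Cartan image).
* Assembly M49 (this composition) is NOT IN PRINT as a theorem about `E` (ref2): new-combination grade.

No `sorry`; no new axioms; evidence only.
-/

-- summit and problem share the name `BirchSwinnertonDyer` (registry layout D-0017)
set_option linter.dupNamespace false

noncomputable section

open scoped Classical MatrixGroups ModularForm NumberField

open Matrix WeierstrassCurve CongruenceSubgroup IsDedekindDomain Field
  Literature.NumberTheory.EllipticCurves
  Literature.NumberTheory.EllipticCurves.Rank1Residual
  Literature.NumberTheory.EllipticCurves.ModularForms
  Literature.NumberTheory.EllipticCurves.GreenbergSelmer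
  Literature.NumberTheory.GaloisRepresentations
  Literature.NumberTheory.GaloisRepresentations.Serre1972

namespace Summit.BirchSwinnertonDyer.BirchSwinnertonDyer.Cruxes.KatoDivisibilityX9.PrimeAdaptedTau

/-! ## §1 Descent `ℤ̄_p⟦T⟧ → Λ` of a divisibility up to a unit (pure algebra; PROVED) -/

section Descent

variable {K : Type*} [NormedField K] [IsUltrametricDist K]

/-- **Lemma A (leading-term induction).** Over an ultrametric normed field: if `u` has integral
coefficients and unit constant term, and `u · F` has integral coefficients, then so does `F`. -/
theorem norm_coeff_le_one_of_mul {u F : PowerSeries K} (hu : ∀ n, ‖PowerSeries.coeff n u‖ ≤ 1)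
    (hu0 : ‖PowerSeries.constantCoeff u‖ = 1) (huF : ∀ n, ‖PowerSeries.coeff n (u * F)‖ ≤ 1) :
    ∀ n, ‖PowerSeries.coeff n F‖ ≤ 1 := by
  intro n
  induction n using Nat.strong_induction_on with
  | _ n ih =>
    have hmem : ((0 : ℕ), n) ∈ Finset.HasAntidiagonal.antidiagonal n :=
      Finset.HasAntidiagonal.mem_antidiagonal.mpr (zero_add n)
    set rest := ∑ ij ∈ (Finset.HasAntidiagonal.antidiagonal n).erase (0, n),
      PowerSeries.coeff ij.1 u * PowerSeries.coeff ij.2 F with hrest_def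
    have hsplit : PowerSeries.coeff n (u * F) =
        PowerSeries.coeff 0 u * PowerSeries.coeff n F + rest := by
      rw [PowerSeries.coeff_mul, ← Finset.add_sum_erase _ _ hmem]
    have hrest : ‖rest‖ ≤ 1 := by
      refine IsUltrametricDist.norm_sum_le_of_forall_le_of_nonneg zero_le_one fun ij hij => ?_
      have hne : ij ≠ (0, n) := Finset.ne_of_mem_erase hij
      have hsum : ij.1 + ij.2 = n :=
        Finset.HasAntidiagonal.mem_antidiagonal.mp (Finset.mem_of_mem_erase hij)
      have hj : ij.2 < n := by
        by_contra hcon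
        apply hne
        have h2 : ij.2 = n := by omega
        have h1 : ij.1 = 0 := by omega
        exact Prod.ext h1 h2
      rw [norm_mul]
      calc ‖PowerSeries.coeff ij.1 u‖ * ‖PowerSeries.coeff ij.2 F‖ ≤ 1 * 1 :=
            mul_le_mul (hu _) (ih _ hj) (norm_nonneg _) zero_le_one
        _ = 1 := one_mul 1
    have hkey : PowerSeries.coeff 0 u * PowerSeries.coeff n F =
        PowerSeries.coeff n (u * F) + -rest := by
      rw [hsplit]; ring
    calc ‖PowerSeries.coeff n F‖ = ‖PowerSeries.coeff 0 u * PowerSeries.coeff n F‖ := by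
          rw [norm_mul, PowerSeries.coeff_zero_eq_constantCoeff, hu0, one_mul]
      _ = ‖PowerSeries.coeff n (u * F) + -rest‖ := by rw [hkey]
      _ ≤ max ‖PowerSeries.coeff n (u * F)‖ ‖-rest‖ := IsUltrametricDist.norm_add_le_max _ _
      _ ≤ 1 := max_le (huF n) (by rw [norm_neg]; exact hrest)

end Descent

section DescentLambda

variable {p : ℕ} [Fact p.Prime]

/-- A `ℚ_p`-power series with `ℤ_p`-integral coefficients comes from `Λ = ℤ_p⟦T⟧` along `ι`. -/
theorem exists_iwasawaToPowerSeries_eq_of_norm_le_one {q : PowerSeries ℚ_[p]}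
    (hq : ∀ n, ‖PowerSeries.coeff n q‖ ≤ 1) :
    ∃ q₀ : IwasawaAlgebra p, iwasawaToPowerSeries p q₀ = q := by
  refine ⟨PowerSeries.mk fun n => (⟨PowerSeries.coeff n q, hq n⟩ : ℤ_[p]), ?_⟩
  ext n
  simp only [iwasawaToPowerSeries, PowerSeries.coeff_map, PowerSeries.coeff_mk]
  rfl

/-- **Descent of the D-Λ2 conclusion to `KatoDivisibilityAt`'s currency.** If
`u · L = h · ι g` in `ℚ̄_p⟦T⟧` with `u, h ∈ ℤ̄_p⟦T⟧` and `u` a unit of `ℤ̄_p⟦T⟧` (`‖u₀‖ = 1`), where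
`L ∈ ℚ_p⟦T⟧` and `g ∈ Λ`, then `L = ι g'` for some multiple `g'` of `g` in `Λ`.  (Proof: `u` is a unit
of `ℚ̄_p⟦T⟧`, so `ι g ∣ L` there; write `ι g = X^k · w`, `w(0) ≠ 0`, get `X^k ∣ L` coefficientwise in
`ℚ_p⟦T⟧`, put `q₀ := (L/X^k) · w⁻¹ ∈ ℚ_p⟦T⟧`, so `q₀ · ι g = L` and, cancelling `ι g`, `u · q₀ = h`;
Lemma A makes `q₀` integral, i.e. `q₀ = ι q`; take `g' := g q`.) -/
theorem exists_dvd_and_iwasawaToPowerSeries_eq {g : IwasawaAlgebra p} {L : PowerSeries ℚ_[p]}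
    {u h : PowerSeries (PadicAlgCl p)} (hu : ∀ n, ‖PowerSeries.coeff n u‖ ≤ 1)
    (hu0 : ‖PowerSeries.constantCoeff u‖ = 1) (hh : ∀ n, ‖PowerSeries.coeff n h‖ ≤ 1)
    (heq : u * PowerSeries.map (algebraMap ℚ_[p] (PadicAlgCl p)) L =
      h * PowerSeries.map (algebraMap ℚ_[p] (PadicAlgCl p)) (iwasawaToPowerSeries p g)) :
    ∃ g' : IwasawaAlgebra p, g ∣ g' ∧ iwasawaToPowerSeries p g' = L := by
  haveI : IsUltrametricDist (PadicAlgCl p) := IsUltrametricDist.of_normedAlgebra ℚ_[p]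
  set j : ℚ_[p] →+* PadicAlgCl p := algebraMap ℚ_[p] (PadicAlgCl p) with hj_def
  have hj : Function.Injective j := (algebraMap ℚ_[p] (PadicAlgCl p)).injective
  have hmapj : Function.Injective (PowerSeries.map j) := PowerSeries.map_injective j hj
  have hu_unit : IsUnit u := by
    refine PowerSeries.isUnit_iff_constantCoeff.mpr (isUnit_iff_ne_zero.mpr fun h0 => ?_)
    rw [h0, norm_zero] at hu0
    exact zero_ne_one hu0
  set G : PowerSeries ℚ_[p] := iwasawaToPowerSeries p g with hG_def
  by_cases hg : g = 0
  · -- then `L = 0`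
    have hL0 : PowerSeries.map j L = 0 := by
      have h0 : u * PowerSeries.map j L = 0 := by
        rw [heq]; simp [hG_def, hg]
      exact hu_unit.mul_right_eq_zero.mp h0
    have hL : L = 0 := hmapj (by rw [hL0, map_zero])
    exact ⟨0, dvd_zero g, by rw [map_zero, hL]⟩
  · have hG : G ≠ 0 := fun h0 =>
      hg (iwasawaToPowerSeries_injective p (by rw [← hG_def, h0, map_zero]))
    have hGK : PowerSeries.map j G ≠ 0 := fun h0 => hG (hmapj (by rw [h0, map_zero]))
    have hGfac : G = PowerSeries.X ^ G.order.toNat * G.divXPowOrder :=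
      PowerSeries.X_pow_order_mul_divXPowOrder.symm
    -- `ι g ∣ L` in `ℚ̄_p⟦T⟧` (`u` is a unit there)
    have hdvdK : PowerSeries.map j G ∣ PowerSeries.map j L := by
      refine ⟨↑hu_unit.unit⁻¹ * h, ?_⟩
      calc PowerSeries.map j L = ↑hu_unit.unit⁻¹ * (u * PowerSeries.map j L) := by
            rw [← mul_assoc, IsUnit.val_inv_mul, one_mul]
        _ = PowerSeries.map j G * (↑hu_unit.unit⁻¹ * h) := by rw [heq]; ring
    set k : ℕ := G.order.toNat with hk_def
    -- `X^k ∣ L` in `ℚ_p⟦T⟧`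
    have hXkK : (PowerSeries.X : PowerSeries (PadicAlgCl p)) ^ k ∣ PowerSeries.map j L := by
      refine dvd_trans ⟨PowerSeries.map j G.divXPowOrder, ?_⟩ hdvdK
      conv_lhs => rw [hGfac]
      rw [map_mul, map_pow, PowerSeries.map_X]
    have hXk : (PowerSeries.X : PowerSeries ℚ_[p]) ^ k ∣ L := by
      rw [PowerSeries.X_pow_dvd_iff]
      intro m hm
      have h1 := (PowerSeries.X_pow_dvd_iff.mp hXkK) m hm
      rw [PowerSeries.coeff_map] at h1
      exact hj (by rw [h1, map_zero])
    obtain ⟨L₁, hL₁⟩ := hXk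
    set wu := G.Unit_of_divided_by_X_pow_order with hwu_def
    have hwu : (↑wu : PowerSeries ℚ_[p]) = G.divXPowOrder :=
      PowerSeries.Unit_of_divided_by_X_pow_order_nonzero hG
    set q₀ : PowerSeries ℚ_[p] := L₁ * ↑wu⁻¹ with hq₀_def
    have hq₀G : q₀ * G = L := by
      rw [hL₁, hq₀_def]
      conv_lhs => rw [hGfac, ← hwu]
      linear_combination (PowerSeries.X ^ k * L₁ : PowerSeries ℚ_[p]) * wu.inv_mul
    -- cancel `ι g`: `u · q₀ = h`
    have huq : u * PowerSeries.map j q₀ = h := by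
      refine mul_right_cancel₀ hGK ?_
      rw [mul_assoc, ← map_mul, hq₀G, heq]
    have hint : ∀ n, ‖PowerSeries.coeff n (PowerSeries.map j q₀)‖ ≤ 1 :=
      norm_coeff_le_one_of_mul hu hu0 fun n => by rw [huq]; exact hh n
    have hint' : ∀ n, ‖PowerSeries.coeff n q₀‖ ≤ 1 := fun n => by
      have := hint n
      rwa [PowerSeries.coeff_map, hj_def, norm_algebraMap'] at this
    obtain ⟨q, hq⟩ := exists_iwasawaToPowerSeries_eq_of_norm_le_one hint'
    refine ⟨g * q, dvd_mul_right g q, ?_⟩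
    rw [map_mul, hq, ← hG_def, mul_comm, hq₀G]

end DescentLambda

/-! ## §2 Witnesses `τ ∈ G^cyc`, `ρ_𝓕(τ) = P U⁺(b) P⁻¹` from the levels of the datum (PROVED) -/

section Weyl

variable (A : Type*) [CommRing A]

/-- The Weyl element `w = (0 1; 1 0) ∈ GL₂(A)` (`w = w⁻¹`). -/
def weyl : GL (Fin 2) A :=
  ⟨!![0, 1; 1, 0], !![0, 1; 1, 0],
    by simp [Matrix.one_fin_two],
    by simp [Matrix.one_fin_two]⟩

variable {A}

/-- `U⁻(c) = w U⁺(c) w⁻¹`. -/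
theorem unipLower_eq_weyl_conj (c : A) :
    HidaFamily.unipLower c = weyl A * HidaFamily.unipUpper c * (weyl A)⁻¹ := by
  apply Units.ext
  simp [weyl, HidaFamily.coe_unipUpper, HidaFamily.coe_unipLower]

end Weyl

section Witness

variable {W : WeierstrassCurve ℚ} {p : ℕ} [Fact p.Prime] {I : Type} [CommRing I] [IsDomain I]
  [IsLocalRing I] [TopologicalSpace I] [IsTopologicalRing I] [Algebra (IwasawaAlgebra p) I]
  (D : HidaFamilyGaloisRepDatum W p I)

/-- A level `b ∈ 𝔲⁺ ∪ 𝔲⁻` of the datum is carried by some `τ ∈ G^cyc = ker χ_p` with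
`ρ_𝓕(τ) = P U⁺(b) P⁻¹` (`P = 1` for an upper level, `P = w` for a lower one). -/
theorem exists_witness_of_mem_levels {b : I} (hb : b ∈ D.upperLevels ∨ b ∈ D.lowerLevels) :
    ∃ (τ : absoluteGaloisGroup ℚ) (P : GL (Fin 2) I),
      GaloisRep.cyclotomicCharacter ℚ p τ = 1 ∧ D.rho τ = P * HidaFamily.unipUpper b * P⁻¹ := by
  rcases hb with hb | hb
  · rw [HidaFamilyGaloisRepDatum.mem_upperLevels_iff, HidaFamilyGaloisRepDatum.mem_Gamma_iff] at hb
    obtain ⟨⟨σ, hσ, hρ⟩, -, -⟩ := hb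
    exact ⟨σ, 1, hσ, by rw [hρ, one_mul, inv_one, mul_one]⟩
  · rw [HidaFamilyGaloisRepDatum.mem_lowerLevels_iff, HidaFamilyGaloisRepDatum.mem_Gamma_iff] at hb
    obtain ⟨⟨σ, hσ, hρ⟩, -, -⟩ := hb
    exact ⟨σ, weyl I, hσ, by rw [hρ, unipLower_eq_weyl_conj]⟩

/-! ## §3 From US-S4's level supply (primes of `𝕀`) to Ochiai's `hτ` (primes of `ℍ = 𝕀⟦T⟧`) -/

/-- **(HC) height-one contraction** for the coefficient ring `𝕀`: every height-one prime `𝔩` of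
`𝕀⟦T⟧` contracts along `C : 𝕀 → 𝕀⟦T⟧` either to `0` or to a height-one prime of `𝕀`.  TRUE for every
noetherian domain — PROVED below (v4.4, `heightOneContraction_of_isNoetherianRing`): going down along
`𝕀 → 𝕀⟦T⟧` holds with the explicit witness `p⟦T⟧ᵉ := ker (𝕀⟦T⟧ → (𝕀/p)⟦T⟧)` (prime, lies over `p`, and
`≤ Q` whenever `p ≤ Q ∩ 𝕀` because `p` is finitely generated), whence `ht(𝔩 ∩ 𝕀) ≤ ht 𝔩 = 1`
(`Ideal.height_eq_height_add_of_liesOver_of_hasGoingDown`), and a nonzero prime of a domain has height `≥ 1`.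
Kept as a named predicate because US-S4-side kernels take it as the hypothesis `hI`. -/
def HeightOneContraction (I : Type) [CommRing I] : Prop :=
  ∀ 𝔩 : PrimeSpectrum (PowerSeries I), 𝔩.asIdeal.height = 1 →
    Ideal.comap (PowerSeries.C : I →+* PowerSeries I) 𝔩.asIdeal = ⊥ ∨
      Ideal.comap (PowerSeries.C : I →+* PowerSeries I) 𝔩.asIdeal ∈
        HidaFamilyGaloisRepDatum.heightOnePrimes I

section HeightOneContractionProof

variable {A : Type} [CommRing A]

/-- The extension `p⟦T⟧ᵉ := ker (A⟦T⟧ → (A ⧸ p)⟦T⟧)` of an ideal `p` of `A`: the power series all of whose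
coefficients lie in `p`. -/
def coeffIdeal (p : Ideal A) : Ideal (PowerSeries A) :=
  RingHom.ker (PowerSeries.map (Ideal.Quotient.mk p))

theorem mem_coeffIdeal_iff (p : Ideal A) (f : PowerSeries A) :
    f ∈ coeffIdeal p ↔ ∀ n, PowerSeries.coeff n f ∈ p := by
  simp only [coeffIdeal, RingHom.mem_ker, PowerSeries.ext_iff, PowerSeries.coeff_map, map_zero,
    Ideal.Quotient.eq_zero_iff_mem]

/-- `p⟦T⟧ᵉ` is prime for `p` prime (kernel of a map to the domain `(A ⧸ p)⟦T⟧`). -/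
theorem coeffIdeal_isPrime (p : Ideal A) [p.IsPrime] : (coeffIdeal p).IsPrime :=
  RingHom.ker_isPrime _

theorem comap_C_coeffIdeal (p : Ideal A) :
    Ideal.comap (PowerSeries.C : A →+* PowerSeries A) (coeffIdeal p) = p := by
  ext x
  simp only [Ideal.mem_comap, mem_coeffIdeal_iff, PowerSeries.coeff_C]
  constructor
  · intro h; simpa using h 0
  · intro h n; split_ifs <;> simp [h]

theorem under_coeffIdeal (p : Ideal A) : (coeffIdeal p).under A = p := by
  rw [Ideal.under_def, PowerSeries.algebraMap_eq]; exact comap_C_coeffIdeal p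

/-- If `p` is finitely generated and the constants `C a`, `a ∈ p`, lie in `Q`, then `p⟦T⟧ᵉ ≤ Q`
(write `f = ∑_{a ∈ s} C a · g_a` coefficientwise over a finite generating set `s`). -/
theorem coeffIdeal_le_of_fg {p : Ideal A} (hp : p.FG) {Q : Ideal (PowerSeries A)}
    (hQ : p ≤ Ideal.comap (PowerSeries.C : A →+* PowerSeries A) Q) : coeffIdeal p ≤ Q := by
  obtain ⟨s, hs⟩ := hp
  intro f hf
  rw [mem_coeffIdeal_iff] at hf
  have hc : ∀ n, ∃ c : s → A, ∑ a : s, c a • (a : A) = PowerSeries.coeff n f := fun n =>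
    Submodule.mem_span_finset'.1 (hs ▸ hf n : PowerSeries.coeff n f ∈ Ideal.span (s : Set A))
  choose c hc using hc
  have hf' : f = ∑ a : s, PowerSeries.C (a : A) * PowerSeries.mk (fun n => c n a) := by
    ext n
    simp only [map_sum, PowerSeries.coeff_C_mul, PowerSeries.coeff_mk, ← hc n, smul_eq_mul]
    exact Finset.sum_congr rfl fun a _ => mul_comm _ _
  rw [hf']
  refine Ideal.sum_mem _ fun a _ => Ideal.mul_mem_right _ _ ?_
  have : (a : A) ∈ p := hs ▸ Ideal.subset_span a.2
  exact hQ this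

/-- **Going down for `A → A⟦T⟧`, `A` noetherian**: below a prime `Q` with `Q ∩ A ⊋ p` sits the prime `p⟦T⟧ᵉ`
lying over `p`. -/
theorem hasGoingDown_powerSeries [IsNoetherianRing A] : Algebra.HasGoingDown A (PowerSeries A) := by
  constructor
  intro p _ Q _ hlt
  refine ⟨coeffIdeal p, ?_, coeffIdeal_isPrime p, ⟨(under_coeffIdeal p).symm⟩⟩
  refine coeffIdeal_le_of_fg (IsNoetherian.noetherian p) ?_
  have h := hlt.le
  rw [Ideal.under_def, PowerSeries.algebraMap_eq] at h
  exact h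

/-- **(HC) IS A THEOREM for every noetherian domain** (v4.4): `ht(𝔩 ∩ A) ≤ ht 𝔩 = 1` by going down, and a
nonzero prime of a domain has height `≥ 1`. -/
theorem heightOneContraction_of_isNoetherianRing (A : Type) [CommRing A] [IsDomain A] [IsNoetherianRing A] :
    HeightOneContraction A := by
  unfold HeightOneContraction
  intro 𝔩 h𝔩
  haveI := hasGoingDown_powerSeries (A := A)
  set P : Ideal A := Ideal.comap (PowerSeries.C : A →+* PowerSeries A) 𝔩.asIdeal with hPdef
  have hPu : P = 𝔩.asIdeal.under A := by rw [Ideal.under_def, PowerSeries.algebraMap_eq]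
  haveI hPprime : P.IsPrime := Ideal.IsPrime.comap _
  by_cases hP : P = ⊥
  · exact Or.inl hP
  · right
    refine ⟨hPprime, le_antisymm ?_ ?_⟩
    · haveI : 𝔩.asIdeal.LiesOver P := ⟨hPu⟩
      have h := Ideal.height_eq_height_add_of_liesOver_of_hasGoingDown P 𝔩.asIdeal
      have : P.height ≤ 𝔩.asIdeal.height := h ▸ le_self_add
      exact this.trans h𝔩.le
    · have h0 : P.height ≠ 0 := fun h0 => hP ((Ideal.height_eq_zero_iff_eq_bot).1 h0)
      exact Order.one_le_iff_ne_zero.2 h0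

/-- **(HC) for every D-Λ1 coefficient domain** (module-finite over `Λ = ℤ_p⟦X⟧`, hence noetherian). -/
theorem heightOneContraction_of_moduleFinite (p : ℕ) [Fact p.Prime] (I : Type) [CommRing I] [IsDomain I]
    [Algebra (IwasawaAlgebra p) I] [Module.Finite (IwasawaAlgebra p) I] : HeightOneContraction I := by
  haveI : IsNoetherianRing I := IsNoetherianRing.of_finite (IwasawaAlgebra p) I
  exact heightOneContraction_of_isNoetherianRing I

end HeightOneContractionProof

/-- **A nonzero level**: `𝔲⁺ ∪ 𝔲⁻ ≠ {0}` (in print: Lang 2016 Thm 2.4 / CLM 2023 Thm 1.4, Prop 6.6 `Γ ⊇ Γ_{B}(𝔞)`,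
`𝔞 ≠ 0`, for a non-CM family — ref2 g32 (c3)/(c4)).  Needed at the height-one `𝔩 ⊂ ℍ` with `𝔩 ∩ 𝕀 = 0` (the
cyclotomic-direction primes), where ANY nonzero level is prime to `𝔩`. -/
def NonzeroLevel : Prop :=
  ∃ b : I, b ≠ 0 ∧ (b ∈ D.upperLevels ∨ b ∈ D.lowerLevels)

/-- **Ochiai's witness supply** — verbatim the hypothesis `hτ` of
`OchiaiTwoVariableDatum.exists_unit_mul_padicLFunction_eq` / `lengthAt_le_of_forall_witness`
(Ochiai 2006 Thm 3 (ii): at each height-one `𝔩` of `ℍ`, a `τ ∈ G^cyc` with `ρ(τ) ∼ U⁺(b)`, `C b ∉ 𝔩`). -/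
def OchiaiWitnessSupply : Prop :=
  ∀ 𝔩 : PrimeSpectrum (PowerSeries I), 𝔩.asIdeal.height = 1 →
    ∃ (τ : absoluteGaloisGroup ℚ) (b : I) (P : GL (Fin 2) I),
      GaloisRep.cyclotomicCharacter ℚ p τ = 1 ∧ PowerSeries.C b ∉ 𝔩.asIdeal ∧
      D.rho τ = P * HidaFamily.unipUpper b * P⁻¹

/-- **Supply conversion (PROVED):** (HC) + a nonzero level + US-S4's `D.LevelSupply` (supply at every
height-one prime of `𝕀`) ⟹ Ochiai's witness supply at every height-one prime of `ℍ = 𝕀⟦T⟧`. -/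
theorem ochiaiWitnessSupply_of_levelSupply (hI : HeightOneContraction I) (hlev : NonzeroLevel D)
    (hsup : D.LevelSupply) : OchiaiWitnessSupply D := by
  intro 𝔩 h𝔩
  rcases hI 𝔩 h𝔩 with hbot | hone
  · obtain ⟨b, hb0, hb⟩ := hlev
    obtain ⟨τ, P, hτ, hρ⟩ := exists_witness_of_mem_levels D hb
    refine ⟨τ, b, P, hτ, fun hmem => hb0 ?_, hρ⟩
    have hb' : b ∈ Ideal.comap (PowerSeries.C : I →+* PowerSeries I) 𝔩.asIdeal :=
      Ideal.mem_comap.mpr hmem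
    rw [hbot] at hb'
    exact Ideal.mem_bot.mp hb'
  · have hsupQ := hsup _ hone
    rw [HidaFamilyGaloisRepDatum.levelSupplyAt_iff] at hsupQ
    rcases hsupQ with ⟨b, hb, hbQ⟩ | ⟨c, hc, hcQ⟩
    · obtain ⟨τ, P, hτ, hρ⟩ := exists_witness_of_mem_levels D (Or.inl hb)
      exact ⟨τ, b, P, hτ, fun hmem => hbQ (Ideal.mem_comap.mpr hmem), hρ⟩
    · obtain ⟨τ, P, hτ, hρ⟩ := exists_witness_of_mem_levels D (Or.inr hc)
      exact ⟨τ, c, P, hτ, fun hmem => hcQ (Ideal.mem_comap.mpr hmem), hρ⟩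

end Witness

/-! ## §4 The per-datum road: composition to `KatoDivisibilityAt W p` (PROVED) -/

section Road

/-- **ROAD (iv) at one Hida datum.**  Ochiai–Kitagawa existence (PRINT, cite-only) + the regime +
(Reg) + (HC) + `−1 ∈ im ρ̄_{E,p}` + Ochiai's `U_{I_W} = 0` at `v ∣ N_W` + a nonzero level +
LEVEL SUPPLY (US-S4's output) ⟹ Kato's divisibility `L_p(f, α) ∈ ι(char_Λ X(E/ℚ_∞))` in the tree's
exact-equality currency.  Composition of the D-Λ2 composite with §§1–3; no new mathematics. -/
theorem katoDivisibilityAt_of_levelSupply (hΛ2 : ochiai2006_nonempty_twoVariableDatum)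
    {W : WeierstrassCurve ℚ} [W.IsElliptic] [W.IsGloballyMinimal] {p : ℕ} [Fact p.Prime]
    {I : Type} [CommRing I] [IsDomain I] [IsLocalRing I] [TopologicalSpace I] [IsTopologicalRing I]
    [Algebra (IwasawaAlgebra p) I] (D : HidaFamilyGaloisRepDatum W p I)
    (hregime : HidaFamilyGaloisRepDatum.Regime W p) (hreg : Ochiai2006.IsRegular p I)
    (hI : HeightOneContraction I)
    (hτ' : ∃ τ' : absoluteGaloisGroup ℚ, ∀ Q : W.geomTorsion (p : ℤ), τ' • Q = -Q)
    (hU : ∀ v : HeightOneSpectrum (𝓞 ℚ),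
      ((Rat.HeightOneSpectrum.primesEquiv v : Nat.Primes) : ℕ) ∣ W.conductorNorm ℤ →
      D.SpecialisationTorsionFreeAt v)
    (hlev : NonzeroLevel D) (hsup : D.LevelSupply) :
    Rank1Residual.KatoDivisibilityAt W p := by
  intro κ γ N _ f hκ hγ hγ' hf Dc
  obtain ⟨Δ⟩ := hΛ2 W p I D hregime
  obtain ⟨g, hg⟩ := (charIdeal_isPrincipal_holds p Dc.X).principal
  have hg' : Dc.charIdeal = Ideal.span {g} := hg
  obtain ⟨u, h, hu, hu0, hh, heq⟩ := Δ.exists_unit_mul_padicLFunction_eq hreg hτ'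
    (ochiaiWitnessSupply_of_levelSupply D hI hlev hsup) hU hκ hγ hγ' Dc hg' f hf
  obtain ⟨g', hgg', hg'L⟩ := exists_dvd_and_iwasawaToPowerSeries_eq hu hu0 hh heq
  exact ⟨g', hg' ▸ Ideal.mem_span_singleton.mpr hgg', hg'L⟩

/-! ## §5 Per-pair package and the class roads (PROVED compositions; OPEN inputs named) -/

/-- **ROAD-(iv) INPUT at the pair `(W, p)`**: some Hida datum `D` over some coefficient domain `𝕀` with
(Reg), (HC), `−1 ∈ im ρ̄`, `U_{I_W} = 0` at `v ∣ N_W`, a nonzero level, AND level supply at every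
height-one prime of `𝕀`.  (The last conjunct is US-S4's output; the rest is `GoodHidaDatumAt`.) -/
def RoadIVInputAt (W : WeierstrassCurve ℚ) [W.IsGloballyMinimal] (p : ℕ) [Fact p.Prime] : Prop :=
  ∃ (I : Type) (_ : CommRing I) (_ : IsDomain I) (_ : IsLocalRing I) (_ : TopologicalSpace I)
    (_ : IsTopologicalRing I) (_ : Algebra (IwasawaAlgebra p) I) (D : HidaFamilyGaloisRepDatum W p I),
    Ochiai2006.IsRegular p I ∧ HeightOneContraction I ∧
    (∃ τ' : absoluteGaloisGroup ℚ, ∀ Q : W.geomTorsion (p : ℤ), τ' • Q = -Q) ∧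
    (∀ v : HeightOneSpectrum (𝓞 ℚ),
      ((Rat.HeightOneSpectrum.primesEquiv v : Nat.Primes) : ℕ) ∣ W.conductorNorm ℤ →
      D.SpecialisationTorsionFreeAt v) ∧
    NonzeroLevel D ∧ D.LevelSupply

/-- **GOOD HIDA DATUM at `(W, p)`** (PRINT-but-unported side conditions, per pair): as `RoadIVInputAt`
plus `Λ → 𝕀` injective (ref1 C′; Hida 1986 p. 558), and with level supply replaced by «no finite
projective image of `ρ_𝓕 mod P` at any height-one `P`»
(the exclusion of US-S4's second disjunct: automatic with a Steinberg prime, US-S4 add. 1 §E / DG12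
Lem 4.4; in general the weight-one / CM-crossing primes).  Sources (ref2 g32 (c1)–(c8) applied): existence Hida 1986 /
Wiles 1988 (held locator Ochiai 2006 p. 1161), (Reg) = `Ochiai2006.IsRegular` (ring), (HC) = Matsumura
Thm 9.5 / Ex 9.9, nonzero level = Lang 2016 Thm 2.4 / CLM 2023 Prop 6.6, `U = 0` = Ochiai 2006 Rem 7.6 +
Thm 3.3 (2). -/
def GoodHidaDatumAt (W : WeierstrassCurve ℚ) [W.IsGloballyMinimal] (p : ℕ) [Fact p.Prime] : Prop :=
  ∃ (I : Type) (_ : CommRing I) (_ : IsDomain I) (_ : IsLocalRing I) (_ : TopologicalSpace I)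
    (_ : IsTopologicalRing I) (_ : Algebra (IwasawaAlgebra p) I) (D : HidaFamilyGaloisRepDatum W p I),
    Function.Injective (algebraMap (IwasawaAlgebra p) I) ∧
    Ochiai2006.IsRegular p I ∧ HeightOneContraction I ∧
    (∃ τ' : absoluteGaloisGroup ℚ, ∀ Q : W.geomTorsion (p : ℤ), τ' • Q = -Q) ∧
    (∀ v : HeightOneSpectrum (𝓞 ℚ),
      ((Rat.HeightOneSpectrum.primesEquiv v : Nat.Primes) : ℕ) ∣ W.conductorNorm ℤ →
      D.SpecialisationTorsionFreeAt v) ∧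
    NonzeroLevel D ∧ (∀ P ∈ HidaFamilyGaloisRepDatum.heightOnePrimes I, ¬ D.FiniteProjectiveImageAt P)

/-- The TARGET's X9 predicate (`Rank1ResidualX9Defs.ClassX9`, the one `KatoDivisibilityOnClassX9` binds):
`¬cm ∧ p ≥ 5 ∧ good(p) ∧ p ∤ a_p ∧ irr(p) ∧ ¬surj(p)`. -/
abbrev X9 (W : WeierstrassCurve ℚ) [W.IsElliptic] [W.IsGloballyMinimal] (p : ℕ) [Fact p.Prime] : Prop :=
  _root_.Summit.BirchSwinnertonDyer.BirchSwinnertonDyer.Rank1Residual.ClassX9 W p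

/-- The regime of D-Λ1/D-Λ2 holds at every X9 pair (its five clauses are X9's first five). -/
theorem regime_of_X9 {W : WeierstrassCurve ℚ} [W.IsElliptic] [W.IsGloballyMinimal] {p : ℕ}
    [Fact p.Prime] (h : X9 W p) : HidaFamilyGaloisRepDatum.Regime W p :=
  ⟨h.1, h.2.1, h.2.2.1, h.2.2.2.1, h.2.2.2.2.1⟩

/-- **CLASS ROAD (PROVED composition): road-(iv) input at every X9 pair ⟹ item 20547's statement
`KatoDivisibilityOnClassX9`, BY NAME.** -/
theorem katoDivisibilityOnClassX9_of_roadIVInput (hΛ2 : ochiai2006_nonempty_twoVariableDatum)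
    (hroad : ∀ (W : WeierstrassCurve ℚ) [W.IsElliptic] [W.IsGloballyMinimal] (p : ℕ) [Fact p.Prime],
      X9 W p → RoadIVInputAt W p) :
    Summit.BirchSwinnertonDyer.Rank1Residual.SmallImageMu.KatoDivisibilityOnClassX9 := by
  intro W _ _ p _ κ γ N _ f hX9 hκ hγ hγ' hf Dc
  obtain ⟨I, _, _, _, _, _, _, D, hreg, hI, hτ', hU, hlev, hsup⟩ := hroad W p hX9
  exact katoDivisibilityAt_of_levelSupply hΛ2 D (regime_of_X9 hX9) hreg hI hτ' hU hlev hsup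
    κ γ f hκ hγ hγ' hf Dc

/-! ### The 5S4 sub-road through US-S4 (US-S4 restated verbatim from `imc/g19/USS4Typed.lean`,
with the target's `X9` predicate in place of `Rank1Residual.ClassX9`) -/

/-- **«`ρ̄_{W,p}` is not split-dihedral»** (verbatim `USS4Typed.NotSplitDihedral`): for every frame
`(e, Φ)` of `E[p]` and every `P ∈ GL₂(𝔽_p)`, the image is NOT inside the normaliser of the split Cartan
`P (* 0; 0 *) P⁻¹`.  On X9 this is type `5S4` (624 of 790 rows). -/
def NotSplitDihedral (W : WeierstrassCurve ℚ) [W.IsElliptic] (p : ℕ) [Fact p.Prime] : Prop :=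
  ∀ (Φ : Multiplicative (AddAut (geomTorsion W p)) ≃* GL (Fin 2) (ZMod p))
    (e : geomTorsion W p ≃+ (Fin 2 → ZMod p)),
    (∀ (g : Multiplicative (AddAut (geomTorsion W p))) (x : geomTorsion W p),
      e (Multiplicative.toAdd g x) =
        ((Φ g : GL (Fin 2) (ZMod p)) : Matrix (Fin 2) (Fin 2) (ZMod p)) *ᵥ e x) →
    ∀ P : GL (Fin 2) (ZMod p),
      ¬ (galoisRepTorsion W p).range.map Φ.toMonoidHom ≤
          Subgroup.normalizer (splitCartan P : Set (GL (Fin 2) (ZMod p)))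

/-- **US-S4 (ROW 45 v3.1; OPEN — nothing asserted; verbatim `USS4TypedV2.UnipotentLevelSupplyS4` = v1 +
ref1's REPAIR C′ binder `Λ ↪ 𝕀`, over the target's `X9`).**  At every 5S4 pair, every Hida datum with
`Λ → 𝕀` injective, every height-one `P ⊂ 𝕀`: level supply at `P` OR finite projective image of
`ρ_𝓕 mod P`.  In print only as Lang 2016 Conj. 6.1.2 (4) (support half); Lang 2016 Thm 2.4 / CLM 2023 Prop 6.6 give
fullness over `B` (a nonzero level), not prime-to-`P` supply.  (ref1 g17 ADDENDUM 2: v1 general form SURVIVES; the binder is uniform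
with the repaired Steinberg pair and excludes the constant-family junk carrier `I = ℤ_p`.) -/
@[conjecture] def UnipotentLevelSupplyS4 : Prop :=
  ∀ (W : WeierstrassCurve ℚ) [W.IsElliptic] [W.IsGloballyMinimal] (p : ℕ) [Fact p.Prime]
    (I : Type) [CommRing I] [IsDomain I] [IsLocalRing I] [TopologicalSpace I] [IsTopologicalRing I]
    [Algebra (IwasawaAlgebra p) I] (D : HidaFamilyGaloisRepDatum W p I),
    Function.Injective (algebraMap (IwasawaAlgebra p) I) →
    X9 W p → NotSplitDihedral W p →
    ∀ P ∈ HidaFamilyGaloisRepDatum.heightOnePrimes I,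
      D.LevelSupplyAt P ∨ D.FiniteProjectiveImageAt P

/-- **Kato divisibility on the 5S4 part of X9** (the scope this road reaches). -/
def KatoDivisibilityOn5S4 : Prop :=
  ∀ (W : WeierstrassCurve ℚ) [W.IsElliptic] [W.IsGloballyMinimal] (p : ℕ) [Fact p.Prime],
    X9 W p → NotSplitDihedral W p → Rank1Residual.KatoDivisibilityAt W p

/-- US-S4 + «no finite projective image at any height-one `P`» ⟹ level supply (pure logic). -/
theorem levelSupply_of_US_S4 (hS4 : UnipotentLevelSupplyS4) {W : WeierstrassCurve ℚ} [W.IsElliptic]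
    [W.IsGloballyMinimal] {p : ℕ} [Fact p.Prime] {I : Type} [CommRing I] [IsDomain I] [IsLocalRing I]
    [TopologicalSpace I] [IsTopologicalRing I] [Algebra (IwasawaAlgebra p) I]
    (D : HidaFamilyGaloisRepDatum W p I) (hΛ : Function.Injective (algebraMap (IwasawaAlgebra p) I))
    (hX9 : X9 W p) (hnd : NotSplitDihedral W p)
    (hnofin : ∀ P ∈ HidaFamilyGaloisRepDatum.heightOnePrimes I, ¬ D.FiniteProjectiveImageAt P) :
    D.LevelSupply :=
  fun P hP => (hS4 W p I D hΛ hX9 hnd P hP).resolve_right (hnofin P hP)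

/-- **THE 5S4 ROAD (PROVED composition; the statement the skeleton `prime_adapted_tau` will register):
Ochiai–Kitagawa existence (PRINT) + US-S4 (OPEN) + a good Hida datum at every 5S4 pair (PRINT-but-
unported) ⟹ Kato's divisibility at every 5S4 pair.** -/
theorem katoDivisibilityOn5S4_of_US_S4 (hΛ2 : ochiai2006_nonempty_twoVariableDatum)
    (hS4 : UnipotentLevelSupplyS4)
    (hgood : ∀ (W : WeierstrassCurve ℚ) [W.IsElliptic] [W.IsGloballyMinimal] (p : ℕ) [Fact p.Prime],
      X9 W p → NotSplitDihedral W p → GoodHidaDatumAt W p) :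
    KatoDivisibilityOn5S4 := by
  intro W _ _ p _ hX9 hnd
  obtain ⟨I, _, _, _, _, _, _, D, hΛ, hreg, hI, hτ', hU, hlev, hnofin⟩ := hgood W p hX9 hnd
  exact katoDivisibilityAt_of_levelSupply hΛ2 D (regime_of_X9 hX9) hreg hI hτ' hU hlev
    (levelSupply_of_US_S4 hS4 D hΛ hX9 hnd hnofin)

/-- Bookkeeping: the class-wide statement restricts to the 5S4 one (so a proof of 20547 by any other
road also discharges this road's conclusion; conversely this road covers 624/790 rows only). -/
theorem katoDivisibilityOn5S4_of_onClassX9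
    (h : Summit.BirchSwinnertonDyer.Rank1Residual.SmallImageMu.KatoDivisibilityOnClassX9) :
    KatoDivisibilityOn5S4 := by
  intro W _ _ p _ hX9 _ κ γ N _ f hκ hγ hγ' hf Dc
  exact h W p κ γ f hX9 hκ hγ hγ' hf Dc

end Road

/-! ## §6 The line: registered stubs (the only `sorry`s) and the kernel-checked composition -/

/-! ## §5b CROSSING CONTROL at the Artin primes (road (iv) ∪ road (v); the per-prime dichotomy is
-desc g30's `HOME/desc/Sketch30.lean` v1.1 acacdc393fe9baa9 §2–§3, copied VERBATIM with attribution —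
defs `OchiaiWitnessAt`, `contraction`, `VerticalComparisonAtNonSupply`, `ExceptionalAt`, theorems
`lengthAt_le_of_witnessAt`, `lengthAt_le_of_dichotomy`; ADAPTED (v4.1, junk-immune single-`Δ` forms):
`CrossingControlledAt`, `verticalComparison_of_witness_off_artin`, `katoDivisibilityAt_of_verticalComparison`;
NEW here: the US-S4 ⟹ «witness off the Artin primes» conversion, the existential-relative `ArtinControlAt`,
`Anomalous`, and the 5S4 kernel WITHOUT any `NoArtinCrossingAt` hypothesis and WITHOUT `∀ Δ`). -/

section Crossing

variable {W : WeierstrassCurve ℚ} [W.IsGloballyMinimal] {p : ℕ} [Fact p.Prime] {I : Type} [CommRing I]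
  [IsDomain I] [IsLocalRing I] [TopologicalSpace I] [IsTopologicalRing I] [Algebra (IwasawaAlgebra p) I]
  (D : HidaFamilyGaloisRepDatum W p I)

/-- **An OCHIAI WITNESS at the height-one prime `𝔩 ⊂ ℍ`** (-desc Sketch30 §2, verbatim): the `𝔩`-instance
of `OchiaiWitnessSupply`. -/
def OchiaiWitnessAt (𝔩 : PrimeSpectrum (PowerSeries I)) : Prop :=
  ∃ (τ : absoluteGaloisGroup ℚ) (b : I) (P : GL (Fin 2) I),
    GaloisRep.cyclotomicCharacter ℚ p τ = 1 ∧ PowerSeries.C b ∉ 𝔩.asIdeal ∧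
    D.rho τ = P * HidaFamily.unipUpper b * P⁻¹

/-- The contraction `𝔩 ∩ 𝕀` of a prime of `ℍ = 𝕀⟦T⟧` along `C` (-desc Sketch30 §2, verbatim). -/
abbrev contraction (𝔩 : PrimeSpectrum (PowerSeries I)) : Ideal I :=
  Ideal.comap (PowerSeries.C : I →+* PowerSeries I) 𝔩.asIdeal

variable {D}

/-- **(A) Ochiai's bound at ONE prime from ONE witness** (-desc Sketch30 §2, verbatim; PROVED from the
D-Λ2 field `thm3`). [cite: Ochiai2006, Thm. 3 (ii) (p. 1164)] -/
theorem lengthAt_le_of_witnessAt (Δ : OchiaiTwoVariableDatum D) (hreg : Ochiai2006.IsRegular p I)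
    (hτ' : ∃ τ' : absoluteGaloisGroup ℚ, ∀ Q : W.geomTorsion (p : ℤ), τ' • Q = -Q)
    {𝔩 : PrimeSpectrum (PowerSeries I)} (h𝔩 : 𝔩.asIdeal.height = 1) (hw : OchiaiWitnessAt D 𝔩) :
    Module.lengthAt (PowerSeries I) Δ.X 𝔩 ≤ Ochiai2006.ordAt (PowerSeries I) Δ.Lp 𝔩 := by
  obtain ⟨τ, b, P, hcyc, hb𝔩, hρ⟩ := hw
  have hb : b ≠ 0 := by
    rintro rfl
    exact hb𝔩 (by simp)
  obtain ⟨m, hm⟩ := Δ.thm3 hreg τ b P hcyc hb hρ hτ'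
  have hpow : PowerSeries.C b ^ m ∉ 𝔩.asIdeal := fun h =>
    hb𝔩 (𝔩.isPrime.mem_of_pow_mem m h)
  have h0 : Ochiai2006.ordAt (PowerSeries I) (PowerSeries.C b ^ m) 𝔩 = 0 :=
    Ochiai2006.ordAt_eq_zero_of_not_mem hpow
  simpa [h0] using hm 𝔩 h𝔩

variable (D)

/-- **(V) VERTICAL COMPARISON AT THE NON-WITNESS PRIMES** (-desc Sketch30 §2, verbatim). -/
def VerticalComparisonAtNonSupply (Δ : OchiaiTwoVariableDatum D) : Prop :=
  ∀ 𝔩 : PrimeSpectrum (PowerSeries I), 𝔩.asIdeal.height = 1 → ¬ OchiaiWitnessAt D 𝔩 →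
    Module.lengthAt (PowerSeries I) Δ.X 𝔩 ≤ Ochiai2006.ordAt (PowerSeries I) Δ.Lp 𝔩

/-- **EXCEPTIONAL at `P`** (TRIVIAL-ZERO locus in the Greenberg–Stevens / Greenberg–Vatsal 2020 Rem. 4.3
sense — NOT Bellaïche–Dimitrov's «exceptional = exotic projective image» and NOT the cell's X10b «exceptional
prime»; -desc Sketch30 §2, verbatim statement): the unramified quotient character `δ_v` (`v ∣ p`) is trivial
modulo `P`, i.e. `a_p(g_P) ≡ 1 (mod P)`.  Forces `a_p(E) ≡ 1 (mod p)` (anomalous) since `δ(Frob_p) − 1` is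
otherwise a unit (ref2 g33 (A5): elementary/known, Mazur 1972). [cite: arXiv:2309.03738, Thm. 2.10;
Greenberg–Vatsal, Adv. Stud. Pure Math. 86 (2020) Rem. 4.3 = arXiv:1806.05659 p. 17]  v4.3: kept as DOCUMENTATION of the
trivial-zero locus only — by ref1 g18 R-5 it is irrelevant to `length_𝔩 ≤ ord_𝔩` at height one. -/
def ExceptionalAt (P : Ideal I) : Prop :=
  ∀ v : HeightOneSpectrum (𝓞 ℚ), ((p : ℕ) : 𝓞 ℚ) ∈ v.asIdeal →
    ∀ σ : absoluteGaloisGroup (v.adicCompletion ℚ), D.delta v σ - 1 ∈ P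

/-- **ARTIN-CROSSING CONTROL for ONE Ochiai datum `Δ`** (v4.1, unified «≤» form of -desc's (B2a)+(B2b); v4.3
NOTE: by ref1 g18 R-5 the (B2b) exceptional sub-case carries NO extra residue — the `p`-local control error is
supported at the height-two point `(P, γ − 1)` — so the whole predicate is PRINT-assemblable, stub 4):
at every NON-witness height-one `𝔩` of characteristic `0` whose contraction `P = 𝔩 ∩ 𝕀` has FINITE projective
image (an Artin = classical octahedral weight-one point `g_P` of the branch), Ochiai's local divisibility
`length_𝔩 X ≤ ord_𝔩 L_p` holds.  CONTENT: (B2a) `g_P` NOT exceptional (`a_p(g_P) ≠ 1`): `length_𝔩 X = 0` for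
the TRUE Selmer dual — PRINT-assemblable: control at `Pℍ` (Ochiai 2006 Prop 5.1, p. 1177) with zero local error +
TORSIONNESS of the weight-one Selmer group (Greenberg–Vatsal, Adv. Stud. Pure Math. 86 (2020) Thm 2 / Prop 4.2
= arXiv:1806.05659 [corpus: p0002 L30–31 Hypothesis A, p0004 L9, p0016 L62]; Hypothesis A automatic on X9
after the `η`-twist) + Nakayama; (B2b) `g_P` EXCEPTIONAL (`a_p(g_P) = 1`, forces `a_p(E) ≡ 1 (mod p)`):
v4.1/v4.2 carried it as the residue desc-C18 — WITHDRAWN in v4.3 (R-5: GV Prop 4.2 covers the exceptional case,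
the error term has no `𝔩`-component; `ℒ`-invariants live at `T = 0` of the fibre, invisible here).  TYPING NOTE (host, v4.1): this
predicate is stated for ONE `Δ` and consumed EXISTENTIALLY (`ArtinControlAt`), never as `∀ Δ`: the
D-Λ2 structure `OchiaiTwoVariableDatum` presents `X = ℍ^n/rel` by FREE fields constrained only by
(P1)–(P4), and at a non-witness prime `𝔩₀` the junk enlargement `X ⊕ ℍ/𝔩₀` satisfies (P1)–(P4) again
((P3) is monotone in `X`, (P4) only binds at witness primes) — so every «`∀ Δ`, bound at a non-witness
prime» statement is FALSE as soon as such a prime exists (v4.0 defect, caught in-seat before audit). -/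
def CrossingControlledAt (Δ : OchiaiTwoVariableDatum D) : Prop :=
  ∀ 𝔩 : PrimeSpectrum (PowerSeries I), 𝔩.asIdeal.height = 1 → ¬ OchiaiWitnessAt D 𝔩 →
    (p : I) ∉ contraction 𝔩 → D.FiniteProjectiveImageAt (contraction 𝔩) →
    Module.lengthAt (PowerSeries I) Δ.X 𝔩 ≤ Ochiai2006.ordAt (PowerSeries I) Δ.Lp 𝔩

variable {D}

/-- **5S4 READING of the dichotomy** (after -desc Sketch30 §2 `verticalComparison_of_witness_off_artin`;
v4.1 unified form; PROVED): witnesses at every NON-Artin height-one prime + Artin-crossing control for `Δ`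
⟹ (V) for `Δ`. -/
theorem verticalComparison_of_witness_off_artin (Δ : OchiaiTwoVariableDatum D)
    (hτ : ∀ 𝔩 : PrimeSpectrum (PowerSeries I), 𝔩.asIdeal.height = 1 →
      ¬ ((p : I) ∉ contraction 𝔩 ∧ D.FiniteProjectiveImageAt (contraction 𝔩)) → OchiaiWitnessAt D 𝔩)
    (hC : CrossingControlledAt D Δ) : VerticalComparisonAtNonSupply D Δ := by
  intro 𝔩 h𝔩 hw
  by_cases hart : (p : I) ∉ contraction 𝔩 ∧ D.FiniteProjectiveImageAt (contraction 𝔩)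
  · exact hC 𝔩 h𝔩 hw hart.1 hart.2
  · exact (hw (hτ 𝔩 h𝔩 hart)).elim

/-- **(A) at witness primes + (V) at the others ⟹ Ochiai's local divisibility at EVERY height-one prime**
(-desc Sketch30 §2, verbatim; PROVED). -/
theorem lengthAt_le_of_dichotomy (Δ : OchiaiTwoVariableDatum D) (hreg : Ochiai2006.IsRegular p I)
    (hτ' : ∃ τ' : absoluteGaloisGroup ℚ, ∀ Q : W.geomTorsion (p : ℤ), τ' • Q = -Q)
    (hV : VerticalComparisonAtNonSupply D Δ)
    (𝔩 : PrimeSpectrum (PowerSeries I)) (h𝔩 : 𝔩.asIdeal.height = 1) :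
    Module.lengthAt (PowerSeries I) Δ.X 𝔩 ≤ Ochiai2006.ordAt (PowerSeries I) Δ.Lp 𝔩 := by
  by_cases hw : OchiaiWitnessAt D 𝔩
  · exact lengthAt_le_of_witnessAt Δ hreg hτ' h𝔩 hw
  · exact hV 𝔩 h𝔩 hw

/-- **The per-datum kernel with (V) in place of level supply** (after -desc Sketch30 §3
`katoDivisibilityAt_of_verticalComparison`; v4.1: stated for ONE Ochiai datum `Δ` with (V) — existence is
the caller's business; PROVED): regime + (Reg) + `−1 ∈ im ρ̄` + `U = 0` at `v ∣ N_W` + (V) for `Δ` ⟹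
`KatoDivisibilityAt W p`. -/
theorem katoDivisibilityAt_of_verticalComparison
    {W : WeierstrassCurve ℚ} [W.IsElliptic] [W.IsGloballyMinimal] {p : ℕ} [Fact p.Prime]
    {I : Type} [CommRing I] [IsDomain I] [IsLocalRing I] [TopologicalSpace I] [IsTopologicalRing I]
    [Algebra (IwasawaAlgebra p) I] {D : HidaFamilyGaloisRepDatum W p I}
    (hreg : Ochiai2006.IsRegular p I)
    (hτ' : ∃ τ' : absoluteGaloisGroup ℚ, ∀ Q : W.geomTorsion (p : ℤ), τ' • Q = -Q)
    (hU : ∀ v : HeightOneSpectrum (𝓞 ℚ),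
      ((Rat.HeightOneSpectrum.primesEquiv v : Nat.Primes) : ℕ) ∣ W.conductorNorm ℤ →
      D.SpecialisationTorsionFreeAt v)
    (Δ : OchiaiTwoVariableDatum D) (hV : VerticalComparisonAtNonSupply D Δ) :
    Rank1Residual.KatoDivisibilityAt W p := by
  intro κ γ N _ f hκ hγ hγ' hf Dc
  obtain ⟨g, hg⟩ := (charIdeal_isPrincipal_holds p Dc.X).principal
  have hg' : Dc.charIdeal = Ideal.span {g} := hg
  obtain ⟨u, hu, hu0, hLp⟩ := Δ.specialise_Lp hreg f hf
  obtain ⟨h, hh, hx⟩ := Δ.specialise_char hreg hU κ γ hκ hγ hγ' Dc g hg' Δ.Lp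
    (lengthAt_le_of_dichotomy Δ hreg hτ' hV)
  obtain ⟨g', hgg', hg'L⟩ := exists_dvd_and_iwasawaToPowerSeries_eq hu hu0 hh (by rw [← hLp, ← hx])
  exact ⟨g', hg' ▸ Ideal.mem_span_singleton.mpr hgg', hg'L⟩

/-- **NEW (host -imc g20): US-S4 ⟹ witnesses OFF the Artin primes.**  At one 5S4 datum with `Λ ↪ 𝕀`, (HC),
a nonzero level and «no finite projective image ABOVE `p`» (elementary for an ordinary family: `χ_univ mod P`
has infinite order on inertia while the unramified quotient does not — a conjunct of `GoodHidaDatumAt'`),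
US-S4's disjunction `LevelSupplyAt P ∨ FiniteProjectiveImageAt P` yields an Ochiai witness at every
height-one `𝔩 ⊂ ℍ` that is not a characteristic-`0` finite-image (Artin) prime.  PROVED. -/
theorem witness_off_artin_of_US_S4 (hS4 : UnipotentLevelSupplyS4) {W : WeierstrassCurve ℚ} [W.IsElliptic]
    [W.IsGloballyMinimal] {p : ℕ} [Fact p.Prime] {I : Type} [CommRing I] [IsDomain I] [IsLocalRing I]
    [TopologicalSpace I] [IsTopologicalRing I] [Algebra (IwasawaAlgebra p) I]
    (D : HidaFamilyGaloisRepDatum W p I) (hΛ : Function.Injective (algebraMap (IwasawaAlgebra p) I))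
    (hX9 : X9 W p) (hnd : NotSplitDihedral W p) (hI : HeightOneContraction I) (hlev : NonzeroLevel D)
    (hnp : ∀ P ∈ HidaFamilyGaloisRepDatum.heightOnePrimes I, (p : I) ∈ P → ¬ D.FiniteProjectiveImageAt P) :
    ∀ 𝔩 : PrimeSpectrum (PowerSeries I), 𝔩.asIdeal.height = 1 →
      ¬ ((p : I) ∉ contraction 𝔩 ∧ D.FiniteProjectiveImageAt (contraction 𝔩)) → OchiaiWitnessAt D 𝔩 := by
  intro 𝔩 h𝔩 hart
  rcases hI 𝔩 h𝔩 with hbot | hone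
  · obtain ⟨b, hb0, hb⟩ := hlev
    obtain ⟨τ, P, hτ, hρ⟩ := exists_witness_of_mem_levels D hb
    refine ⟨τ, b, P, hτ, fun hmem => hb0 ?_, hρ⟩
    have hb' : b ∈ Ideal.comap (PowerSeries.C : I →+* PowerSeries I) 𝔩.asIdeal :=
      Ideal.mem_comap.mpr hmem
    rw [hbot] at hb'
    exact Ideal.mem_bot.mp hb'
  · rcases hS4 W p I D hΛ hX9 hnd _ hone with hsupQ | hfin
    · rw [HidaFamilyGaloisRepDatum.levelSupplyAt_iff] at hsupQ
      rcases hsupQ with ⟨b, hb, hbQ⟩ | ⟨c, hc, hcQ⟩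
      · obtain ⟨τ, P, hτ, hρ⟩ := exists_witness_of_mem_levels D (Or.inl hb)
        exact ⟨τ, b, P, hτ, fun hmem => hbQ (Ideal.mem_comap.mpr hmem), hρ⟩
      · obtain ⟨τ, P, hτ, hρ⟩ := exists_witness_of_mem_levels D (Or.inr hc)
        exact ⟨τ, c, P, hτ, fun hmem => hcQ (Ideal.mem_comap.mpr hmem), hρ⟩
    · exfalso
      by_cases hp : (p : I) ∈ contraction 𝔩
      · exact hnp _ hone hp hfin
      · exact hart ⟨hp, hfin⟩

/-- **ARTIN-CROSSING CONTROL at the pair** (v4.1, EXISTENTIAL-RELATIVE — junk-immune): for every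
admitted datum (`Λ ↪ 𝕀`) that carries SOME Ochiai datum, there is an Ochiai datum `Δ` (in nature: the one on
the TRUE Selmer dual) with Artin-crossing control.  Trivially true at pairs whose branches have no Artin
non-witness prime (class A ∪ B-pm by DG12 Lem 4.4 + GV 2020 Thm 5.6; B-pg rows without a companion crossing). -/
def ArtinControlAt (W : WeierstrassCurve ℚ) [W.IsGloballyMinimal] (p : ℕ) [Fact p.Prime] : Prop :=
  ∀ (I : Type) [CommRing I] [IsDomain I] [IsLocalRing I] [TopologicalSpace I] [IsTopologicalRing I]
    [Algebra (IwasawaAlgebra p) I] (D : HidaFamilyGaloisRepDatum W p I),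
    Function.Injective (algebraMap (IwasawaAlgebra p) I) → Nonempty (OchiaiTwoVariableDatum D) →
    ∃ Δ : OchiaiTwoVariableDatum D, CrossingControlledAt D Δ

/-- **ANOMALOUS pair**: `a_p(E) ≡ 1 (mod p)` — the only pairs whose branches can carry an EXCEPTIONAL
(trivial-zero) Artin point (`δ(Frob_p) − 1` is otherwise a unit of `𝕀`; -desc MEMO §30.8 (A5), ref2 g33:
elementary/known, Mazur 1972).  v4.3: a DATA-SIDE row predicate only (γ0′ table `R45-ANOM-v1.tsv`); NOT used by
the stubs any more — by ref1 g18 R-5 (host-confirmed, MEMO-imc 28.16) an exceptional Artin point carries NO extra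
residue for `length_𝔩 ≤ ord_𝔩` at height one (the `p`-local control error is supported at the height-TWO point
`(P, γ − 1)`), so v4.1/v4.2's split of Artin control into non-anomalous / anomalous stubs is MERGED (stub 4). -/
def Anomalous (W : WeierstrassCurve ℚ) [W.IsElliptic] [W.IsGloballyMinimal] (p : ℕ) [Fact p.Prime] :
    Prop :=
  (p : ℤ) ∣ W.frobeniusTrace p - 1

/-- **A STRUCTURAL GOOD HIDA DATUM at `(W, p)` — v4.4** (replaces v2/v3's `GoodHidaDatumAt`; what stub 3 asserts):
`Λ ↪ 𝕀`, (Reg), `−1 ∈ im ρ̄`, `U_{I_W} = 0` at `v ∣ N_W`, a nonzero level ((HC) is no longer a conjunct — it is the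
theorem `heightOneContraction_of_moduleFinite`, supplied inside the kernel), and NO finite projective image at
the height-one primes ABOVE `p` (elementary for an ordinary family: `χ_univ mod P` has infinite order on `I_p`
while the unramified quotient `δ` does not; v2's «at ALL height-one P» was false at the Artin points — ref1 R-3 —
and is GONE: the Artin points are handled by (B2), stub 4). -/
def GoodHidaDatumStructAt (W : WeierstrassCurve ℚ) [W.IsGloballyMinimal] (p : ℕ) [Fact p.Prime] : Prop :=
  ∃ (I : Type) (_ : CommRing I) (_ : IsDomain I) (_ : IsLocalRing I) (_ : TopologicalSpace I)
    (_ : IsTopologicalRing I) (_ : Algebra (IwasawaAlgebra p) I) (D : HidaFamilyGaloisRepDatum W p I),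
    Function.Injective (algebraMap (IwasawaAlgebra p) I) ∧ Ochiai2006.IsRegular p I ∧
    (∃ τ' : absoluteGaloisGroup ℚ, ∀ Q : W.geomTorsion (p : ℤ), τ' • Q = -Q) ∧
    (∀ v : HeightOneSpectrum (𝓞 ℚ),
      ((Rat.HeightOneSpectrum.primesEquiv v : Nat.Primes) : ℕ) ∣ W.conductorNorm ℤ →
      D.SpecialisationTorsionFreeAt v) ∧
    NonzeroLevel D ∧
    (∀ P ∈ HidaFamilyGaloisRepDatum.heightOnePrimes I, (p : I) ∈ P → ¬ D.FiniteProjectiveImageAt P)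

/-- **THE 5S4 KERNEL v4.4 (PROVED): Λ2-existence + US-S4 + a structural good datum + Artin-crossing control
at the pair ⟹ `KatoDivisibilityAt W p`** — no `NoArtinCrossingAt`, no `∀ Δ`; (HC) supplied by the theorem
`heightOneContraction_of_moduleFinite` from `D.moduleFinite`. -/
theorem katoDivisibilityAt_of_US_S4_of_control (hΛ2 : ochiai2006_nonempty_twoVariableDatum)
    (hS4 : UnipotentLevelSupplyS4) {W : WeierstrassCurve ℚ} [W.IsElliptic] [W.IsGloballyMinimal]
    {p : ℕ} [Fact p.Prime] (hX9 : X9 W p) (hnd : NotSplitDihedral W p) (hg : GoodHidaDatumStructAt W p)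
    (hA : ArtinControlAt W p) : Rank1Residual.KatoDivisibilityAt W p := by
  obtain ⟨I, _, _, _, _, _, _, D, hΛ, hreg, hτ', hU, hlev, hnp⟩ := hg
  have hI : HeightOneContraction I := by
    haveI := D.moduleFinite
    exact heightOneContraction_of_moduleFinite p I
  obtain ⟨Δ, hC⟩ := hA I D hΛ (hΛ2 W p I D (regime_of_X9 hX9))
  exact katoDivisibilityAt_of_verticalComparison hreg hτ' hU Δ
    (verticalComparison_of_witness_off_artin Δ (witness_off_artin_of_US_S4 hS4 D hΛ hX9 hnd hI hlev hnp) hC)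

/-- **Kato divisibility on the Cartan part of X9** — verbatim v2's `stub_cartanRows` statement = -desc
Sketch30's `KatoDivisibilityOnCartan` (OWNER: road (v) «CM-crossing dichotomy», -desc g30; inputs B1
residual-characteristic CM-crossing control (PRINT), B2 as here, B3 generic-crossing residue =
desc-C17 ⟸ (V″) (OPEN; -desc g31 road (v′): ⟸ μ-table + desc-C19), existence/(Reg)/(U)/(−1)). -/
def KatoDivisibilityOnCartan : Prop :=
  ∀ (W : WeierstrassCurve ℚ) [W.IsElliptic] [W.IsGloballyMinimal] (p : ℕ) [Fact p.Prime],
    X9 W p → ¬ NotSplitDihedral W p → Rank1Residual.KatoDivisibilityAt W p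

end Crossing

section Line

/-- **stub 1 (cite-only, PRINT):** Ochiai 2006 Theorem 3 / Props 4.9, 5.2 / Thm 6.7 (= Kitagawa 1994 Thm
1.1) existence of the two-variable datum — the D-Λ2 §5 named fact `ochiai2006_nonempty_twoVariableDatum`
(a prover closes it by cite threading / `(h : Fact)`, never by construction). -/
theorem stub_ochiaiKitagawaDatum : ochiai2006_nonempty_twoVariableDatum := by
  sorry

/-- **stub 2 (OPEN — THE load-bearing stub): US-S4 = ROW 45 v3.1** (`UnipotentLevelSupplyS4`; Lang 2016
Conj. 6.1.2 (4) support half; ref2 M50: not in print; ref1 g17 (w3)/(w3′): SURVIVES ×3 as typed). -/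
theorem stub_unipotentLevelSupplyS4 : UnipotentLevelSupplyS4 := by
  sorry

/-- **stub 3 (PRINT-but-unported per pair; one per-pair risk (Reg)):** at every 5S4 pair a STRUCTURAL good
Hida datum `GoodHidaDatumStructAt` — existence with `Λ ↪ 𝕀` (Hida 1986 / Wiles 1988; held locator Ochiai
2006 p. 1161), (Reg) = `Ochiai2006.IsRegular` for the chosen `𝕀` (**may fail** — the per-pair risk) — (HC) is
NO LONGER asked (v4.4: theorem `heightOneContraction_of_moduleFinite`) —, `−1 ∈ im ρ̄` (5S4 ⊇ scalars), `U_{I_W} = 0` at `v ∣ N_W` (Ochiai 2006 Rem 7.6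
+ Thm 3.3 (2); ref2 (c6) / ref1 CONCUR), a nonzero level (Lang 2016 Thm 2.4 / CLM 2023 Prop 6.6), and «no
finite projective image above `p`» (ordinary filtration: `χ_univ mod P` has infinite order on `I_p`).  NO
crossing hypothesis (v3's `NoArtinCrossingAt` is gone).  Size: L (several independent ports). -/
theorem stub_goodHidaDatum5S4 :
    ∀ (W : WeierstrassCurve ℚ) [W.IsElliptic] [W.IsGloballyMinimal] (p : ℕ) [Fact p.Prime],
      X9 W p → NotSplitDihedral W p → GoodHidaDatumStructAt W p := by
  sorry

/-- **stub 4 (B2 — PRINT-assemblable on ALL 624 5S4 rows; v4.3 = v4.2's stubs 4 ∧ 5 MERGED by ref1 g18 R-5):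
Artin-crossing control at every 5S4 pair.**  For nature's Ochiai datum on the TRUE Selmer dual, at each char-0
non-witness height-one `𝔩 = Pℍ` over an Artin (octahedral weight-one) point `g_P`: (i) CONTROL at `Pℍ` — over
`ℚ_∞` the `Λ♯`-character of `𝒯` is trivial and `F⁻A = 𝕀^∨(δ)` is unramified, so the `p`-local error
`H⁰(ℚ_{∞,𝔭}, F⁻A)/P` has TRIVIAL `Γ`-action: its dual is a quotient of `ℍ/(d, γ − 1)`, `d := δ(Frob_p) − 1`,
supported at the height-TWO point `(P, γ − 1)`; since `γ − 1 ∉ Pℍ` it has NO `𝔩`-component — whether or not the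
point is exceptional (`d ∈ P`, trivial zero) [Ochiai 2006 Prop 5.1 p. 1177 [corpus: ochiai2006 p0021 L48–62];
Maksoud, Ann. Inst. Fourier 75 (2025) = arXiv:1811.05368 Prop 10 (control an ISOMORPHISM for principal `𝔞` once
`I_p` acts trivially on `𝒟⁻`), Lemme 68 (exact control at the weight-one prime, `α = 1` allowed), Lemme 69, Prop 67;
`H⁰ = 0` by irreducibility of `ρ̄`; `ℓ ∣ N` terms = (U)]; (ii) TORSIONNESS of `X(ℚ_∞, ρ_{g_P} ⊗ η⁻¹)`
(Greenberg–Vatsal 2020 Thm 2 / Prop 4.2 = arXiv:1806.05659 [corpus: p0002 L30–31 Hyp A, no unramified-at-`p`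
clause; p0016 L62], exceptional case INCLUDED (Rem 4.3 p. 17: `T^t ∣ θ` at the point); unique ordinary branch
through `(g_P, ε)`, Thm 5.2; Maksoud Thm A(i) / Cor 37) + Nakayama ⟹ `length_𝔩 X = 0`.  The `ℒ`-invariant /
exact-order question (Greenberg–Stevens; D–M 2023, Schanuel-conditional) lives in `L_p^{alg}(g_P, T)` at `T = 0`,
INVISIBLE at height one — desc-C18 is NOT needed for this stub (ref1 R-5; host MEMO-imc 28.16; it corrects
v4.2's stub 5 and -desc (B2b)).  In print AS ONE CHAIN for `p ∤ N` `p`-regular weight-one points (Maksoud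
L68–69/P67/T59, Kato transported to weight one in `𝒪⟦T⟧[1/p]`); for the `p`-RAMIFIED crossing points of `f_E`'s
branch (ours: `ρ_{g_P}|I_p ≅ ε ⊕ 1`, `ε` of order `4`, so `p ∣` level) ASSEMBLED from Bellaïche–Dimitrov, Duke 165
(2016) Thm 1.1 (`p ∣ M`, smooth/étale), Ochiai 2006 Prop 5.1 / Maksoud Prop 10, GV 2020 Prop 4.2 / Maksoud Thm A(i)
— ref2 g34 (n1).  Scope: 624/624 5S4 rows (A ∪ B-pm rows have no Artin point at all — DG12 Lem 4.4 + GV 2020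
Thm 5.6, PRINT-ASSEMBLED per ref2 g33 — so the statement has content on the 371 B-pg rows).  Why it might fail:
the assembly at a `p`-ramified weight-ONE vertical prime for the exact local conditions of Ochiai's `Sel_𝒯` is not
printed as one statement; and the stub must be discharged for the opaque datum class, i.e. by exhibiting nature's
`Δ` with (P1)–(P4) — a PORT of Ochiai's theorems for the true Selmer dual rides along.  Size: L–XL. -/
theorem stub_artinControl5S4 :
    ∀ (W : WeierstrassCurve ℚ) [W.IsElliptic] [W.IsGloballyMinimal] (p : ℕ) [Fact p.Prime],
      X9 W p → NotSplitDihedral W p → ArtinControlAt W p := by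
  sorry

/-- **stub 5 (v4.3 numbering; the CARTAN HALF — OWNER = road (v) «CM-crossing dichotomy», -desc g30 `HOME/desc/Sketch30.lean`
acacdc393fe9baa9, `katoDivisibilityOnCartan_of_roadV`): Kato divisibility on the 166 normaliser-of-Cartan
rows.**  No longer «no mechanism»: mechanism = witness OR crossing control at every height-one `𝔩` — B1
residual-characteristic CM-crossing control (PRINT: CM congruence + Rubin 1991 + Finis 2006 / Hida 2010
anticyclotomic μ = 0), B2 as above (dihedral weight-one points: Shapiro + CFT + Brumer; the exceptional sub-case B2b / desc-C18 is VACUOUS for `length ≤ ord` by ref1 R-5), B3 generic CM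
crossing = residue desc-C17 ⟸ (V″) «no vertical divisor of the χ-branch two-variable Katz L at a
non-arithmetic weight» (OPEN, not in print, no counterexample; ref2 g33 M56); -desc g31 road (v′) `HOME/desc/Sketch31.lean`
e596c16291f27003 re-anchors the analytic half on the μ-table / `AnalyticMuZeroX9` (a per-row LEDGER with residues desc-C17/C19,
honestly not a μ-mechanism).  A second registered line (slug proposal `cm_crossing`) proves exactly this statement;
this stub is its socket. -/
theorem stub_cartanRows : KatoDivisibilityOnCartan := by
  sorry

/-- **The composition (kernel-checked, no `sorry` of its own): the five stub statements imply the ROUTE DECL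
`OneSidedTwistSqueezeX9.KatoDivisibilityX9` BY NAME** — cases on `NotSplitDihedral`; the 5S4 branch is the v4.1
kernel `katoDivisibilityAt_of_US_S4_of_control` (US-S4 witnesses off the Artin primes + Artin-crossing control for
one Ochiai datum); v4.3: no case split on `Anomalous` (R-5). -/
theorem KatoDivisibilityX9_of :
    ochiai2006_nonempty_twoVariableDatum →
    UnipotentLevelSupplyS4 →
    (∀ (W : WeierstrassCurve ℚ) [W.IsElliptic] [W.IsGloballyMinimal] (p : ℕ) [Fact p.Prime],
      X9 W p → NotSplitDihedral W p → GoodHidaDatumStructAt W p) →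
    (∀ (W : WeierstrassCurve ℚ) [W.IsElliptic] [W.IsGloballyMinimal] (p : ℕ) [Fact p.Prime],
      X9 W p → NotSplitDihedral W p → ArtinControlAt W p) →
    KatoDivisibilityOnCartan →
    Summit.BirchSwinnertonDyer.BirchSwinnertonDyer.Theses.OneSidedTwistSqueezeX9.KatoDivisibilityX9 := by
  intro hΛ2 hS4 hgood hart hcart
  show Summit.BirchSwinnertonDyer.Rank1Residual.SmallImageMu.KatoDivisibilityOnClassX9
  intro W _ _ p _ κ γ N _ f hX9 hκ hγ hγ' hf Dc
  by_cases hnd : NotSplitDihedral W p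
  · exact katoDivisibilityAt_of_US_S4_of_control hΛ2 hS4 hX9 hnd (hgood W p hX9 hnd) (hart W p hX9 hnd)
      κ γ f hκ hγ hγ' hf Dc
  · exact hcart W p hX9 hnd κ γ f hκ hγ hγ' hf Dc

/-- The line closes the crux once the five stubs are theorems (sanity: instantiate the composition). -/
theorem KatoDivisibilityX9_of_stubs :
    Summit.BirchSwinnertonDyer.BirchSwinnertonDyer.Theses.OneSidedTwistSqueezeX9.KatoDivisibilityX9 :=
  KatoDivisibilityX9_of stub_ochiaiKitagawaDatum stub_unipotentLevelSupplyS4 stub_goodHidaDatum5S4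
    stub_artinControl5S4 stub_cartanRows

end Line


end Summit.BirchSwinnertonDyer.BirchSwinnertonDyer.Cruxes.KatoDivisibilityX9.PrimeAdaptedTau

end
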